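import Mathlib
import Summits.Ventures.PercRepro2.Defs
import Summits.Ventures.PercRepro2.Independence
import Summits.Ventures.PercRepro2.Harris
import Summits.Ventures.PercRepro2.Graph
import Summits.Ventures.PercRepro2.Events
import Summits.Ventures.PercRepro2.BHKEvents
import Summits.Ventures.PercRepro2.BHKAvoidWeighted
import Summits.Ventures.PercRepro2.BasePendant
import Summits.Ventures.PercRepro2.PsiPendantLemmas

/-!
# Pendant vertices reduce the (Ψ) inequality of the (PM⁺) line (PercRepro2, p2)

Roles `s = a₂` (`C_s = H`), `t = a₁` (`C_t = L`), `Q = {s ↮ t}`, `μ = P(· | Q)`; a mark `o`, a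
vertex `u`, an up-set `𝓤` of `H`-clusters (meant `⊆ {u ∈ ·}`).  The (Ψ) inequality on `𝓤`
(P2-G16-GENSUB.md §1.9; the consequent of `psi_of_psiSub`), multiplied out with
`q = P(Q)`, `oL = P(o ∈ C_t, Q)`, `oH = P(o ∈ C_s, Q)`, `aH = P(u ∈ C_s, Q)`,
`oLH = P(u ∈ C_s, o ∈ C_t, Q)`, `oHH = P(u ∈ C_s, o ∈ C_s, Q)`, `Ug = P(C_s ∈ 𝓤, Q)`,
`oLU = P(C_s ∈ 𝓤, o ∈ C_t, Q)`, reads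

  **(Ψ)_𝓤**  `oLU·q² ≤ Ug·((q − aH)·oL + q·(oLH + oHH) − aH·oH)`

(`μ(o ∈ C_t | 𝓤) − μ(o ∈ C_t) ≤ Cov_μ(1[o ∈ C_s ∪ C_t], 1[u ∈ C_s])`).  (Ψ)_𝓤 is preserved when
a PENDANT vertex `v` (its only edge `f = {v, y}`, `v ∉ {s, t}`) is attached; the pendant edge is
handled by the weight-pinning identity `prob_eq_pin` on the same configuration space
(P2-G17-PSI.md §3; lemmas in `PsiPendantLemmas.lean`):

* `psi_pendant_unmarked` — `v ∉ {o, u}`: (Ψ)_𝓤 under `p[f↦0]` (the pendant edge deleted) and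
  under `p[f↦1]` (the pendant edge contracted) imply (Ψ)_𝓤 under `p` — the six `f`-free masses
  are common to the three weight vectors and the inequality is linear in the two `𝓤`-masses;
* `psi_pendant_mark` — `v = o` (the mark is pendant, `o ∉ {s, t, u}`): (Ψ)_𝓤 under `p[f↦0]`
  for the mark `y` (the instance on `G − o`) implies (Ψ)_𝓤 under `p` for the mark `o` — the
  `o`-masses are `p f` times the `y`-masses with `f` closed, `Ug` mixes two `f`-pinned masses of
  which the contracted one is the larger, and the bracket is nonnegative by
  `bhk_same_cluster_events`;
* `psi_pendant_cond` (`PsiPendantCond.lean`) — `v = u`.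

So an instance of (Ψ) with a pendant vertex off `{s, t}` reduces to instances on the graph with
the pendant edge deleted or contracted; a counterexample, if any, has minimum degree `≥ 2` off
`{s, t}`.
-/

namespace Summit.Ventures.PercRepro2

section PsiPendant

variable {V : Type*} {E : Type*} [Fintype E] [DecidableEq E] [Fintype V] [DecidableEq V]
  {R : Type*} [CommRing R] [LinearOrder R] [IsStrictOrderedRing R]

omit [Fintype V] [DecidableEq V] in
/-- **Unmarked pendant vertex.** Let `v ∉ {s, t, o, u}` have the single edge `f = {v, y}`. If the
(Ψ) inequality on `𝓤` holds with `f` pinned closed and with `f` pinned open, it holds for `p`. -/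
theorem psi_pendant_unmarked (p : E → R) (hp : IsProbVec p) (ends : E → Sym2 V) (s t o u v y : V)
    (f : E) (hf : ends f = s(v, y)) (hleaf : ∀ e, v ∈ ends e → e = f) (hvy : v ≠ y)
    (hvs : v ≠ s) (hvt : v ≠ t) (hvo : v ≠ o) (hvu : v ≠ u) (𝓤 : Set (Set V))
    (h0 : prob (Function.update p f 0) (clusterInEvent ends s 𝓤 ∩ clusterInEvent ends t {W : Set V | o ∈ W} ∩
          (connEvent ends s t)ᶜ) * prob (Function.update p f 0) (connEvent ends s t)ᶜ * prob (Function.update p f 0) (connEvent ends s t)ᶜ ≤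
      prob (Function.update p f 0) (clusterInEvent ends s 𝓤 ∩ (connEvent ends s t)ᶜ) *
        ((prob (Function.update p f 0) (connEvent ends s t)ᶜ - prob (Function.update p f 0) (connEvent ends s u ∩ (connEvent ends s t)ᶜ)) *
            prob (Function.update p f 0) (clusterInEvent ends t {W : Set V | o ∈ W} ∩ (connEvent ends s t)ᶜ) +
          prob (Function.update p f 0) (connEvent ends s t)ᶜ *
            (prob (Function.update p f 0) (connEvent ends s u ∩ clusterInEvent ends t {W : Set V | o ∈ W} ∩
          (connEvent ends s t)ᶜ) +
              prob (Function.update p f 0) (connEvent ends s u ∩ clusterInEvent ends s {W : Set V | o ∈ W} ∩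
          (connEvent ends s t)ᶜ)) -
          prob (Function.update p f 0) (connEvent ends s u ∩ (connEvent ends s t)ᶜ) *
            prob (Function.update p f 0) (clusterInEvent ends s {W : Set V | o ∈ W} ∩ (connEvent ends s t)ᶜ)))
    (h1 : prob (Function.update p f 1) (clusterInEvent ends s 𝓤 ∩ clusterInEvent ends t {W : Set V | o ∈ W} ∩
          (connEvent ends s t)ᶜ) * prob (Function.update p f 1) (connEvent ends s t)ᶜ * prob (Function.update p f 1) (connEvent ends s t)ᶜ ≤
      prob (Function.update p f 1) (clusterInEvent ends s 𝓤 ∩ (connEvent ends s t)ᶜ) *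
        ((prob (Function.update p f 1) (connEvent ends s t)ᶜ - prob (Function.update p f 1) (connEvent ends s u ∩ (connEvent ends s t)ᶜ)) *
            prob (Function.update p f 1) (clusterInEvent ends t {W : Set V | o ∈ W} ∩ (connEvent ends s t)ᶜ) +
          prob (Function.update p f 1) (connEvent ends s t)ᶜ *
            (prob (Function.update p f 1) (connEvent ends s u ∩ clusterInEvent ends t {W : Set V | o ∈ W} ∩
          (connEvent ends s t)ᶜ) +
              prob (Function.update p f 1) (connEvent ends s u ∩ clusterInEvent ends s {W : Set V | o ∈ W} ∩
          (connEvent ends s t)ᶜ)) -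
          prob (Function.update p f 1) (connEvent ends s u ∩ (connEvent ends s t)ᶜ) *
            prob (Function.update p f 1) (clusterInEvent ends s {W : Set V | o ∈ W} ∩ (connEvent ends s t)ᶜ))) :
    prob p (clusterInEvent ends s 𝓤 ∩ clusterInEvent ends t {W : Set V | o ∈ W} ∩
          (connEvent ends s t)ᶜ) * prob p (connEvent ends s t)ᶜ * prob p (connEvent ends s t)ᶜ ≤
      prob p (clusterInEvent ends s 𝓤 ∩ (connEvent ends s t)ᶜ) *
        ((prob p (connEvent ends s t)ᶜ - prob p (connEvent ends s u ∩ (connEvent ends s t)ᶜ)) *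
            prob p (clusterInEvent ends t {W : Set V | o ∈ W} ∩ (connEvent ends s t)ᶜ) +
          prob p (connEvent ends s t)ᶜ *
            (prob p (connEvent ends s u ∩ clusterInEvent ends t {W : Set V | o ∈ W} ∩
          (connEvent ends s t)ᶜ) +
              prob p (connEvent ends s u ∩ clusterInEvent ends s {W : Set V | o ∈ W} ∩
          (connEvent ends s t)ᶜ)) -
          prob p (connEvent ends s u ∩ (connEvent ends s t)ᶜ) *
            prob p (clusterInEvent ends s {W : Set V | o ∈ W} ∩ (connEvent ends s t)ᶜ)) := by
  have hw : 0 ≤ p f := hp.nonneg f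
  have hw1 : p f ≤ 1 := hp.le_one f
  -- the f-free events are invariant under forcing f
  have hQ : ∀ c (ω : Config E), Function.update ω f c ∈ (connEvent ends s t)ᶜ ↔
      ω ∈ (connEvent ends s t)ᶜ := fun c ω => by
    simp only [Set.mem_compl_iff, mem_connEvent]
    rw [conn_update_leaf_iff hf hleaf hvy c hvs.symm hvt.symm]
  have hOL : ∀ c (ω : Config E), Function.update ω f c ∈ clusterInEvent ends t {W : Set V | o ∈ W} ↔
      ω ∈ clusterInEvent ends t {W : Set V | o ∈ W} := fun c ω => by
    simp only [mem_clusterInEvent, Set.mem_setOf_eq, mem_cluster]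
    exact conn_update_leaf_iff hf hleaf hvy c hvt.symm hvo.symm
  have hOH : ∀ c (ω : Config E), Function.update ω f c ∈ clusterInEvent ends s {W : Set V | o ∈ W} ↔
      ω ∈ clusterInEvent ends s {W : Set V | o ∈ W} := fun c ω => by
    simp only [mem_clusterInEvent, Set.mem_setOf_eq, mem_cluster]
    exact conn_update_leaf_iff hf hleaf hvy c hvs.symm hvo.symm
  have hAU : ∀ c (ω : Config E), Function.update ω f c ∈ connEvent ends s u ↔
      ω ∈ connEvent ends s u := fun c ω => by
    simp only [mem_connEvent]
    exact conn_update_leaf_iff hf hleaf hvy c hvs.symm hvu.symm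
  -- the six f-free masses
  have eQ1 := prob_update_one_of_invariant p f (hQ true)
  have eQ0 := prob_update_zero_of_invariant p f (hQ false)
  have eOL1 := prob_update_one_of_invariant p f (A := clusterInEvent ends t {W : Set V | o ∈ W} ∩
    (connEvent ends s t)ᶜ) (fun ω => by simp only [Set.mem_inter_iff, hOL, hQ])
  have eOL0 := prob_update_zero_of_invariant p f (A := clusterInEvent ends t {W : Set V | o ∈ W} ∩
    (connEvent ends s t)ᶜ) (fun ω => by simp only [Set.mem_inter_iff, hOL, hQ])
  have eOH1 := prob_update_one_of_invariant p f (A := clusterInEvent ends s {W : Set V | o ∈ W} ∩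
    (connEvent ends s t)ᶜ) (fun ω => by simp only [Set.mem_inter_iff, hOH, hQ])
  have eOH0 := prob_update_zero_of_invariant p f (A := clusterInEvent ends s {W : Set V | o ∈ W} ∩
    (connEvent ends s t)ᶜ) (fun ω => by simp only [Set.mem_inter_iff, hOH, hQ])
  have eAU1 := prob_update_one_of_invariant p f (A := connEvent ends s u ∩ (connEvent ends s t)ᶜ)
    (fun ω => by simp only [Set.mem_inter_iff, hAU, hQ])
  have eAU0 := prob_update_zero_of_invariant p f (A := connEvent ends s u ∩ (connEvent ends s t)ᶜ)
    (fun ω => by simp only [Set.mem_inter_iff, hAU, hQ])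
  have eAOL1 := prob_update_one_of_invariant p f (A := connEvent ends s u ∩
    clusterInEvent ends t {W : Set V | o ∈ W} ∩ (connEvent ends s t)ᶜ)
    (fun ω => by simp only [Set.mem_inter_iff, hAU, hOL, hQ])
  have eAOL0 := prob_update_zero_of_invariant p f (A := connEvent ends s u ∩
    clusterInEvent ends t {W : Set V | o ∈ W} ∩ (connEvent ends s t)ᶜ)
    (fun ω => by simp only [Set.mem_inter_iff, hAU, hOL, hQ])
  have eAOH1 := prob_update_one_of_invariant p f (A := connEvent ends s u ∩
    clusterInEvent ends s {W : Set V | o ∈ W} ∩ (connEvent ends s t)ᶜ)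
    (fun ω => by simp only [Set.mem_inter_iff, hAU, hOH, hQ])
  have eAOH0 := prob_update_zero_of_invariant p f (A := connEvent ends s u ∩
    clusterInEvent ends s {W : Set V | o ∈ W} ∩ (connEvent ends s t)ᶜ)
    (fun ω => by simp only [Set.mem_inter_iff, hAU, hOH, hQ])
  -- the two 𝓤-masses mix
  have eU := prob_eq_pin p (clusterInEvent ends s 𝓤 ∩ (connEvent ends s t)ᶜ) f
  have eUOL := prob_eq_pin p (clusterInEvent ends s 𝓤 ∩
    clusterInEvent ends t {W : Set V | o ∈ W} ∩ (connEvent ends s t)ᶜ) f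
  rw [eQ1, eOL1, eOH1, eAU1, eAOL1, eAOH1] at h1
  rw [eQ0, eOL0, eOH0, eAU0, eAOL0, eAOH0] at h0
  rw [eU, eUOL]
  exact psi_mix_algebra hw hw1 h0 h1

/-- **Pendant mark.** Let the mark `o ∉ {s, t, u}` have the single edge `f = {o, y}`. If the (Ψ)
inequality on `𝓤` holds for the mark `y` with `f` pinned closed (the instance on `G − o`), it holds
for the mark `o` under `p`. -/
theorem psi_pendant_mark (p : E → R) (hp : IsProbVec p) (ends : E → Sym2 V) (s t o u y : V)
    (f : E) (hf : ends f = s(o, y)) (hleaf : ∀ e, o ∈ ends e → e = f) (hoy : o ≠ y)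
    (hos : o ≠ s) (hot : o ≠ t) (hou : o ≠ u) {𝓤 : Set (Set V)} (h𝓤 : IsUpperSet 𝓤)
    (h0 : prob (Function.update p f 0) (clusterInEvent ends s 𝓤 ∩ clusterInEvent ends t {W : Set V | y ∈ W} ∩
          (connEvent ends s t)ᶜ) * prob (Function.update p f 0) (connEvent ends s t)ᶜ * prob (Function.update p f 0) (connEvent ends s t)ᶜ ≤
      prob (Function.update p f 0) (clusterInEvent ends s 𝓤 ∩ (connEvent ends s t)ᶜ) *
        ((prob (Function.update p f 0) (connEvent ends s t)ᶜ - prob (Function.update p f 0) (connEvent ends s u ∩ (connEvent ends s t)ᶜ)) *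
            prob (Function.update p f 0) (clusterInEvent ends t {W : Set V | y ∈ W} ∩ (connEvent ends s t)ᶜ) +
          prob (Function.update p f 0) (connEvent ends s t)ᶜ *
            (prob (Function.update p f 0) (connEvent ends s u ∩ clusterInEvent ends t {W : Set V | y ∈ W} ∩
          (connEvent ends s t)ᶜ) +
              prob (Function.update p f 0) (connEvent ends s u ∩ clusterInEvent ends s {W : Set V | y ∈ W} ∩
          (connEvent ends s t)ᶜ)) -
          prob (Function.update p f 0) (connEvent ends s u ∩ (connEvent ends s t)ᶜ) *
            prob (Function.update p f 0) (clusterInEvent ends s {W : Set V | y ∈ W} ∩ (connEvent ends s t)ᶜ))) :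
    prob p (clusterInEvent ends s 𝓤 ∩ clusterInEvent ends t {W : Set V | o ∈ W} ∩
          (connEvent ends s t)ᶜ) * prob p (connEvent ends s t)ᶜ * prob p (connEvent ends s t)ᶜ ≤
      prob p (clusterInEvent ends s 𝓤 ∩ (connEvent ends s t)ᶜ) *
        ((prob p (connEvent ends s t)ᶜ - prob p (connEvent ends s u ∩ (connEvent ends s t)ᶜ)) *
            prob p (clusterInEvent ends t {W : Set V | o ∈ W} ∩ (connEvent ends s t)ᶜ) +
          prob p (connEvent ends s t)ᶜ *
            (prob p (connEvent ends s u ∩ clusterInEvent ends t {W : Set V | o ∈ W} ∩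
          (connEvent ends s t)ᶜ) +
              prob p (connEvent ends s u ∩ clusterInEvent ends s {W : Set V | o ∈ W} ∩
          (connEvent ends s t)ᶜ)) -
          prob p (connEvent ends s u ∩ (connEvent ends s t)ᶜ) *
            prob p (clusterInEvent ends s {W : Set V | o ∈ W} ∩ (connEvent ends s t)ᶜ)) := by
  have hw : 0 ≤ p f := hp.nonneg f
  have hw1 : p f ≤ 1 := hp.le_one f
  have hp0 : IsProbVec (Function.update p f 0) := hp.update f le_rfl zero_le_one
  -- f-free events: Q and {u ∈ C_s}
  have hQ : ∀ c (ω : Config E), Function.update ω f c ∈ (connEvent ends s t)ᶜ ↔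
      ω ∈ (connEvent ends s t)ᶜ := fun c ω => by
    simp only [Set.mem_compl_iff, mem_connEvent]
    rw [conn_update_leaf_iff hf hleaf hoy c hos.symm hot.symm]
  have hAU : ∀ c (ω : Config E), Function.update ω f c ∈ connEvent ends s u ↔
      ω ∈ connEvent ends s u := fun c ω => by
    simp only [mem_connEvent]
    exact conn_update_leaf_iff hf hleaf hoy c hos.symm hou.symm
  have eQ1 := prob_update_one_of_invariant p f (hQ true)
  have eQ0 := prob_update_zero_of_invariant p f (hQ false)
  have eAU1 := prob_update_one_of_invariant p f (A := connEvent ends s u ∩ (connEvent ends s t)ᶜ)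
    (fun ω => by simp only [Set.mem_inter_iff, hAU, hQ])
  have eAU0 := prob_update_zero_of_invariant p f (A := connEvent ends s u ∩ (connEvent ends s t)ᶜ)
    (fun ω => by simp only [Set.mem_inter_iff, hAU, hQ])
  -- the o-events force f open
  have hOLsub : clusterInEvent ends t {W : Set V | o ∈ W} ⊆ openEdge f := fun ω hω =>
    mem_openEdge_of_conn_leaf hf hleaf hoy hot.symm hω
  have hOHsub : clusterInEvent ends s {W : Set V | o ∈ W} ⊆ openEdge f := fun ω hω =>
    mem_openEdge_of_conn_leaf hf hleaf hoy hos.symm hω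
  -- transfer of the o-events (f forced open) to the y-events (f forced closed)
  have tOL : ∀ ω : Config E, Function.update ω f true ∈ clusterInEvent ends t {W : Set V | o ∈ W} ↔
      Function.update ω f false ∈ clusterInEvent ends t {W : Set V | y ∈ W} := fun ω => by
    simp only [mem_clusterInEvent, Set.mem_setOf_eq, mem_cluster]
    exact conn_update_true_leaf_iff hf hleaf hoy hot.symm
  have tOH : ∀ ω : Config E, Function.update ω f true ∈ clusterInEvent ends s {W : Set V | o ∈ W} ↔
      Function.update ω f false ∈ clusterInEvent ends s {W : Set V | y ∈ W} := fun ω => by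
    simp only [mem_clusterInEvent, Set.mem_setOf_eq, mem_cluster]
    exact conn_update_true_leaf_iff hf hleaf hoy hos.symm
  have tQ : ∀ ω : Config E, Function.update ω f true ∈ (connEvent ends s t)ᶜ ↔
      Function.update ω f false ∈ (connEvent ends s t)ᶜ := fun ω => by
    rw [hQ true, hQ false]
  have tAU : ∀ ω : Config E, Function.update ω f true ∈ connEvent ends s u ↔
      Function.update ω f false ∈ connEvent ends s u := fun ω => by
    rw [hAU true, hAU false]
  have tUOL : ∀ ω : Config E, Function.update ω f true ∈ (clusterInEvent ends s 𝓤 ∩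
      clusterInEvent ends t {W : Set V | o ∈ W} ∩ (connEvent ends s t)ᶜ) ↔
      Function.update ω f false ∈ (clusterInEvent ends s 𝓤 ∩
      clusterInEvent ends t {W : Set V | y ∈ W} ∩ (connEvent ends s t)ᶜ) := fun ω => by
    simp only [Set.mem_inter_iff]
    rw [tOL ω, tQ ω]
    constructor
    · rintro ⟨⟨hU, hL⟩, hq⟩
      refine ⟨⟨?_, hL⟩, hq⟩
      have hsy : ¬ Conn ends (Function.update ω f true) s y := by
        intro hsy
        apply hq
        simp only [mem_connEvent]
        rw [conn_update_leaf_iff hf hleaf hoy false hos.symm hot.symm,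
          ← conn_update_leaf_iff hf hleaf hoy true hos.symm hot.symm]
        have hL' : Conn ends (Function.update ω f true) t y := by
          rw [conn_update_leaf_iff hf hleaf hoy true hot.symm hoy.symm,
            ← conn_update_leaf_iff hf hleaf hoy false hot.symm hoy.symm]
          exact hL
        exact conn_trans hsy (conn_symm hL')
      rw [mem_clusterInEvent] at hU ⊢
      rwa [cluster_update_true_eq_update_false hf hleaf hoy hos.symm hsy] at hU
    · rintro ⟨⟨hU, hL⟩, hq⟩
      refine ⟨⟨?_, hL⟩, hq⟩
      have hsy : ¬ Conn ends (Function.update ω f true) s y := by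
        intro hsy
        apply hq
        simp only [mem_connEvent]
        rw [conn_update_leaf_iff hf hleaf hoy false hos.symm hot.symm,
          ← conn_update_leaf_iff hf hleaf hoy true hos.symm hot.symm]
        have hL' : Conn ends (Function.update ω f true) t y := by
          rw [conn_update_leaf_iff hf hleaf hoy true hot.symm hoy.symm,
            ← conn_update_leaf_iff hf hleaf hoy false hot.symm hoy.symm]
          exact hL
        exact conn_trans hsy (conn_symm hL')
      rw [mem_clusterInEvent] at hU ⊢
      rwa [cluster_update_true_eq_update_false hf hleaf hoy hos.symm hsy]
  -- the o-masses under p are p f times the y-masses under p[f↦0]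
  have eOL : prob p (clusterInEvent ends t {W : Set V | o ∈ W} ∩ (connEvent ends s t)ᶜ) = p f * prob (Function.update p f 0) (clusterInEvent ends t {W : Set V | y ∈ W} ∩ (connEvent ends s t)ᶜ) := by
    rw [prob_eq_mul_prob_update_one_of_subset p f (Set.inter_subset_left.trans hOLsub)]
    congr 1
    exact prob_update_one_eq_prob_update_zero p f
      (fun ω => by simp only [Set.mem_inter_iff]; rw [tOL ω, tQ ω])
  have eOH : prob p (clusterInEvent ends s {W : Set V | o ∈ W} ∩ (connEvent ends s t)ᶜ) = p f * prob (Function.update p f 0) (clusterInEvent ends s {W : Set V | y ∈ W} ∩ (connEvent ends s t)ᶜ) := by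
    rw [prob_eq_mul_prob_update_one_of_subset p f (Set.inter_subset_left.trans hOHsub)]
    congr 1
    exact prob_update_one_eq_prob_update_zero p f
      (fun ω => by simp only [Set.mem_inter_iff]; rw [tOH ω, tQ ω])
  have eAOL : prob p (connEvent ends s u ∩ clusterInEvent ends t {W : Set V | o ∈ W} ∩
          (connEvent ends s t)ᶜ) = p f * prob (Function.update p f 0) (connEvent ends s u ∩ clusterInEvent ends t {W : Set V | y ∈ W} ∩
          (connEvent ends s t)ᶜ) := by
    rw [prob_eq_mul_prob_update_one_of_subset p f
      (Set.inter_subset_left.trans (Set.inter_subset_right.trans hOLsub))]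
    congr 1
    exact prob_update_one_eq_prob_update_zero p f
      (fun ω => by simp only [Set.mem_inter_iff]; rw [tAU ω, tOL ω, tQ ω])
  have eAOH : prob p (connEvent ends s u ∩ clusterInEvent ends s {W : Set V | o ∈ W} ∩
          (connEvent ends s t)ᶜ) = p f * prob (Function.update p f 0) (connEvent ends s u ∩ clusterInEvent ends s {W : Set V | y ∈ W} ∩
          (connEvent ends s t)ᶜ) := by
    rw [prob_eq_mul_prob_update_one_of_subset p f
      (Set.inter_subset_left.trans (Set.inter_subset_right.trans hOHsub))]
    congr 1
    exact prob_update_one_eq_prob_update_zero p f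
      (fun ω => by simp only [Set.mem_inter_iff]; rw [tAU ω, tOH ω, tQ ω])
  have eUOL : prob p (clusterInEvent ends s 𝓤 ∩ clusterInEvent ends t {W : Set V | o ∈ W} ∩
          (connEvent ends s t)ᶜ) = p f * prob (Function.update p f 0) (clusterInEvent ends s 𝓤 ∩ clusterInEvent ends t {W : Set V | y ∈ W} ∩
          (connEvent ends s t)ᶜ) := by
    rw [prob_eq_mul_prob_update_one_of_subset p f
      (Set.inter_subset_left.trans (Set.inter_subset_right.trans hOLsub))]
    congr 1
    exact prob_update_one_eq_prob_update_zero p f tUOL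
  -- Ug mixes, and the contracted mass dominates the deleted one
  have eU := prob_eq_pin p (clusterInEvent ends s 𝓤 ∩ (connEvent ends s t)ᶜ) f
  have hUle : prob (Function.update p f 0) (clusterInEvent ends s 𝓤 ∩ (connEvent ends s t)ᶜ) ≤ prob (Function.update p f 1) (clusterInEvent ends s 𝓤 ∩ (connEvent ends s t)ᶜ) := by
    refine prob_update_zero_le_prob_update_one hp f (fun ω hω => ?_)
    rw [Set.mem_inter_iff] at hω ⊢
    refine ⟨isUpperSet_clusterInEvent ends s h𝓤 (update_false_le_update_true ω f) hω.1, ?_⟩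
    rw [hQ true]
    rw [hQ false] at hω
    exact hω.2
  -- the bracket of the y-instance is nonnegative
  have hB : 0 ≤ (prob (Function.update p f 0) (connEvent ends s t)ᶜ - prob (Function.update p f 0) (connEvent ends s u ∩ (connEvent ends s t)ᶜ)) * prob (Function.update p f 0) (clusterInEvent ends t {W : Set V | y ∈ W} ∩ (connEvent ends s t)ᶜ) + prob (Function.update p f 0) (connEvent ends s t)ᶜ * (prob (Function.update p f 0) (connEvent ends s u ∩ clusterInEvent ends t {W : Set V | y ∈ W} ∩
          (connEvent ends s t)ᶜ) + prob (Function.update p f 0) (connEvent ends s u ∩ clusterInEvent ends s {W : Set V | y ∈ W} ∩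
          (connEvent ends s t)ᶜ)) - prob (Function.update p f 0) (connEvent ends s u ∩ (connEvent ends s t)ᶜ) * prob (Function.update p f 0) (clusterInEvent ends s {W : Set V | y ∈ W} ∩ (connEvent ends s t)ᶜ) := by
    have hqa : prob (Function.update p f 0) (connEvent ends s u ∩ (connEvent ends s t)ᶜ) ≤ prob (Function.update p f 0) (connEvent ends s t)ᶜ := prob_mono hp0 Set.inter_subset_right
    have hsame := bhk_same_cluster_events (Function.update p f 0) hp0 ends s t
      (isUpperSet_memFamily u) (isUpperSet_memFamily y)
    rw [clusterInEvent_memFamily_eq_connEvent ends s u] at hsame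
    have h1 : 0 ≤ prob (Function.update p f 0) (clusterInEvent ends t {W : Set V | y ∈ W} ∩ (connEvent ends s t)ᶜ) := prob_nonneg hp0 _
    have h2 : 0 ≤ prob (Function.update p f 0) (connEvent ends s u ∩ clusterInEvent ends t {W : Set V | y ∈ W} ∩
          (connEvent ends s t)ᶜ) := prob_nonneg hp0 _
    have h3 : 0 ≤ prob (Function.update p f 0) (connEvent ends s t)ᶜ := prob_nonneg hp0 _
    nlinarith [mul_nonneg (sub_nonneg.2 hqa) h1, mul_nonneg h3 h2, hsame]
  rw [eQ0, eAU0] at h0 hB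
  rw [eOL, eOH, eAOL, eAOH, eUOL, eU]
  exact psi_mark_algebra hw hB hUle h0

end PsiPendant

end Summit.Ventures.PercRepro2
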